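import Summits.CriticalPhenomena.PercolationContinuityZ3.Theorems.Transplant.SkelFrm1HoldsAllL
import Summits.CriticalPhenomena.PercolationContinuityZ3.Theorems.Transplant.PlanarSkeletonFrmScaledCoarse
import HarnessLib

/-!
# The refuter's PRE-GO data on "HOMOGENEOUS MULTI-TYPE" skeletons (the next rung (D-s2) / `U_s`): SAME-CHART homogeneity collapses a
# multi-type frames-only skeleton to ONE type (so that class is CLOSED by N2); FINE-CHART homogeneity of the coarse types is ROUGH
# (a fine frame by `c` translates `⌊φ/N⌋` up to `+{0,1}` and EXACTLY iff `N ∣ c`), with the `±1` cylinder sandwich it induces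

builds on p205010 (kernel theorem, internal audit signed; external expert review pending): §1's unconditional theorem runs through the CLOSED
frames-only node N2 (`samePDropOfSkeletonFrm₁_holds`, «SkelFrm1HoldsAllL» p423837, audited AUDIT-FRM1 2026-08-26; the near-one gluing in its
cone builds on p205010).  NOTHING is claimed about any OPEN node (`U_s` = `SamePDropOfSkeletonFrmScaled₁`, U, the end-state node): this file
only records which typed form of "homogeneous multi-type" is already closed and which is genuinely new.
Lane `prim-bschramm`, seat `prim-bschramm-p5` gen 24 (refuter / sharpness seat; P5-SHARPNESS §54, pre-GO attack on the design P3-NILPOTENT §18.4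
(D-s2) requested by RULING D-s (b) "refuter first").  Helper file (`--supports stmt-CriticalPhenomena-4575 --as helper`); def-free.
* §1 (`PlanarSkeletonFrm`, multi-type): if the base type `t` is EXCHANGED with every other type by a graph automorphism translating THE SKELETON'S
  OWN chart (`β t = t'`, `φ ∘ β = φ + (φ t' − φ t)`), then the `φ`-translating automorphisms are transitive (`frames_singleton_of_exchangeable`,
  `exchangeable_iff_transitive`) and **`θ_v(p_c) = 0` at every vertex, UNCONDITIONALLY** (`criticalContinuity_of_exchangeable_holds`: the
  one-type skeleton `{Φ with types := {t}}` and N2).  So a "homogeneous multi-type frames-only node" whose homogeneity is typed against the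
  skeleton chart is N2 verbatim — the next rung's homogeneity must refer to a FINER chart, i.e. to a `PlanarSkeletonFrmScaled` (one type, `L ≤ N`).
* §2 (`PlanarSkeletonFrmScaled`, the coarse chart `Φ.coarse = ⌊φ/N⌋` of P3's dictionary «PlanarSkeletonFrmScaledCoarse»): a fine frame `α`
  (`φ ∘ α = φ + c`) is a ROUGH coarse frame — `⌊c/N⌋ ≤ ψ(α w) − ψ(w) ≤ ⌊c/N⌋ + 1` coordinatewise (`coarse_rough_translate`) — and an EXACT
  coarse frame **iff `N ∣ c`** (`coarse_translate_iff_dvd`; ⇐ is P3's `coarse_translate_of_dvd`, ⇒ iterates `α` from a vertex: `k ↦ ⌊(a + kc)/N⌋`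
  is an arithmetic progression only if `N ∣ c`), iff `α` preserves the residue types (`residue_preserved_iff_dvd`).  Hence the automorphisms
  EXCHANGING two distinct coarse types are never coarse frames (`not_coarseFrame_of_not_dvd`), and they carry coarse cylinders onto SHIFTED coarse
  cylinders within the sandwich `cyl ψ (α t) n ⊆ α '' cyl ψ t (n+1)`, `α '' cyl ψ t n ⊆ cyl ψ (α t) (n+1)` (`image_coarseCyl_subset`,
  `coarseCyl_subset_image`) — the per-type LEVEL-0 data of an N2 re-run over `ψ` are conjugate under type exchange only up to this `±1`.
* §3 `N_le_L` (the step length never exceeds the Lipschitz constant: the dictionary regime `L ≤ N` is `L = N`).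
[cite: KozmaNitzan2024, §4 pp. 15–16 (boxes and their translates; Lemma 8: the role of the lattice symmetries)] [cite: BenjaminiSchramm1996, Conj. 4]
[cite: MartineauTassion2017, §3.2]
-/

noncomputable section

namespace Summit.CriticalPhenomena.PercolationContinuityZ3.Theorems.Transplant

open SimpleGraph Literature.Probability.LatticeModels Literature.Probability.Percolation
open scoped Classical

/-! ## §1 Same-chart homogeneity: a multi-type `PlanarSkeletonFrm` with exchangeable types is a one-type skeleton; `θ_v(p_c) = 0` by N2 -/

namespace PlanarSkeletonFrm

variable {V : Type} {G : SimpleGraph V} [G.LocallyFinite]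

/-- **Exchangeable types give transitive frames from ONE base vertex**: if every type `t' ∈ types` is `β t` for an automorphism `β` translating the
chart by `φ t' − φ t`, then every vertex is `α t` for an automorphism translating the chart by `φ v − φ t` (compose the frame of `v` with the
exchange map of its type). [cite: KozmaNitzan2024, §4 p. 15 (boxes and their translates)] -/
theorem frames_singleton_of_exchangeable (Φ : PlanarSkeletonFrm G) {t : V}
    (hex : ∀ t' ∈ Φ.types, ∃ β : G ≃g G, β t = t' ∧ ∀ w, Φ.φ (β w) = Φ.φ w + (Φ.φ t' - Φ.φ t)) (v : V) :
    ∃ s ∈ ({t} : Finset V), ∃ α : G ≃g G, α s = v ∧ ∀ w, Φ.φ (α w) = Φ.φ w + (Φ.φ v - Φ.φ s) := by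
  obtain ⟨t', ht', α, hαt, hα⟩ := Φ.frame v
  obtain ⟨β, hβt, hβ⟩ := hex t' ht'
  refine ⟨t, Finset.mem_singleton_self _, β.trans α, ?_, fun w => ?_⟩
  · show α (β t) = v
    rw [hβt, hαt]
  · show Φ.φ (α (β w)) = Φ.φ w + (Φ.φ v - Φ.φ t)
    rw [hα, hβ]
    abel

/-- **Normal form**: the types are exchangeable from `t` iff the `φ`-translating automorphisms carry `t` to EVERY vertex (same-chart homogeneity =
transitivity of the translating group = the one-type input). [cite: KozmaNitzan2024, §4 p. 16 (Lemma 8)] -/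
theorem exchangeable_iff_transitive (Φ : PlanarSkeletonFrm G) {t : V} :
    (∀ t' ∈ Φ.types, ∃ β : G ≃g G, β t = t' ∧ ∀ w, Φ.φ (β w) = Φ.φ w + (Φ.φ t' - Φ.φ t)) ↔
      ∀ v : V, ∃ α : G ≃g G, α t = v ∧ ∀ w, Φ.φ (α w) = Φ.φ w + (Φ.φ v - Φ.φ t) := by
  constructor
  · intro hex v
    obtain ⟨s, hs, α, hαs, hα⟩ := Φ.frames_singleton_of_exchangeable hex v
    rw [Finset.mem_singleton] at hs
    subst hs
    exact ⟨α, hαs, hα⟩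
  · intro h t' _
    exact h t'

/-- **THEOREM (UNCONDITIONAL in the tree): a multi-type frames-only skeleton whose base type `t` is exchanged with every type by automorphisms
translating ITS OWN chart gives `θ_v(p_c) = 0` at every vertex** — the skeleton `{Φ with types := {t}}` is a one-type `PlanarSkeletonFrm`
((κ) at `t` is the field at `t ∈ types`) and the CLOSED node N2 applies (`criticalContinuity_of_frmNode₁ samePDropOfSkeletonFrm₁_holds`;
Φ2, `p_c < 1`, quasi-transitivity, uniqueness are derived there).  So "homogeneous multi-type" typed against the skeleton chart is NOT a new
node.  builds on p205010 (kernel theorem, internal audit signed; external expert review pending).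
[cite: BenjaminiSchramm1996, Conj. 4] [cite: KozmaNitzan2024, §4 Theorem 6; §4 p. 16 (Lemma 8)] -/
theorem criticalContinuity_of_exchangeable_holds (Φ : PlanarSkeletonFrm G) {t : V} (ht : t ∈ Φ.types)
    (hex : ∀ t' ∈ Φ.types, ∃ β : G ≃g G, β t = t' ∧ ∀ w, Φ.φ (β w) = Φ.φ w + (Φ.φ t' - Φ.φ t)) (v : V) :
    theta G v (criticalProbIOf G v) = 0 :=
  criticalContinuity_of_frmNode₁ samePDropOfSkeletonFrm₁_holds G
    { Φ with
      types := {t}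
      frame := Φ.frames_singleton_of_exchangeable hex
      cyl_connected := fun s hs ℓ hℓ => by
        rw [Finset.mem_singleton] at hs
        subst hs
        exact Φ.cyl_connected s ht ℓ hℓ }
    rfl v

/-- **Chart-free form of the same theorem** (the hypothesis read off the statement): a 1-Lipschitz `φ`, finitely many base vertices with translating
frames, a degree bound, unit steps and connected cylinders at the base vertices, and ONE base vertex `t` from which every base vertex is reached by
a `φ`-translating automorphism ⟹ `θ_v(p_c) = 0` everywhere.  builds on p205010 (kernel theorem, internal audit signed; external expert review pending).
[cite: BenjaminiSchramm1996, Conj. 4] [cite: KozmaNitzan2024, §4 p. 16 (Lemma 8)] -/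
theorem theta_criticalProb_eq_zero_of_exchangeable_types (φ : V → Site 2)
    (lip : ∀ ⦃u v : V⦄, G.Adj u v → ∀ i : Fin 2, |φ u i - φ v i| ≤ 1) (types : Finset V)
    (frame : ∀ v : V, ∃ t ∈ types, ∃ α : G ≃g G, α t = v ∧ ∀ w, φ (α w) = φ w + (φ v - φ t))
    (Δ : ℕ) (degree_le : ∀ v : V, G.degree v ≤ Δ)
    (step : ∀ (v : V) (i : Fin 2) (σ : ℤˣ), ∃ v' : V, G.Adj v v' ∧ φ v' = φ v + Pi.single i (σ : ℤ))
    (cyl_connected : ∀ t ∈ types, ∀ ℓ : ℕ, 1 ≤ ℓ → (G.induce {w | φ w - φ t ∈ box 2 ℓ}).Connected)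
    {t : V} (ht : t ∈ types) (hex : ∀ t' ∈ types, ∃ β : G ≃g G, β t = t' ∧ ∀ w, φ (β w) = φ w + (φ t' - φ t)) (v : V) :
    theta G v (criticalProbIOf G v) = 0 :=
  criticalContinuity_of_exchangeable_holds ⟨φ, lip, types, frame, Δ, degree_le, step, cyl_connected⟩ ht hex v

end PlanarSkeletonFrm

/-! ## §2 Fine-chart homogeneity of the COARSE types is rough: a fine frame translates `⌊φ/N⌋` up to `+{0,1}`, exactly iff `N ∣ c` -/

namespace PlanarSkeletonFrmScaled

/-- **Rough additivity of the Euclidean quotient**: `a/N + c/N ≤ (a + c)/N ≤ a/N + c/N + 1` (`N > 0`). [folklore] -/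
theorem ediv_add_ediv_le (a c : ℤ) {N : ℤ} (hN : 0 < N) :
    a / N + c / N ≤ (a + c) / N ∧ (a + c) / N ≤ a / N + c / N + 1 := by
  have ha := Int.mul_ediv_add_emod a N
  have hc := Int.mul_ediv_add_emod c N
  have ha0 := Int.emod_nonneg a hN.ne'
  have hc0 := Int.emod_nonneg c hN.ne'
  have ha1 := Int.emod_lt_of_pos a hN
  have hc1 := Int.emod_lt_of_pos c hN
  have hsum : a + c = (a % N + c % N) + N * (a / N + c / N) := by
    rw [mul_add]
    linarith
  have hq : (a + c) / N = (a % N + c % N) / N + (a / N + c / N) := by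
    rw [hsum, Int.add_mul_ediv_left _ _ hN.ne']
  have hr0 : 0 ≤ (a % N + c % N) / N := Int.ediv_nonneg (by linarith) hN.le
  have hr1 : (a % N + c % N) / N < 2 := Int.ediv_lt_of_lt_mul hN (by linarith)
  constructor <;> linarith

variable {V : Type} {G : SimpleGraph V} [G.LocallyFinite] (Φ : PlanarSkeletonFrmScaled G)

/-- **A fine frame is a ROUGH coarse frame**: if `φ (α w) = φ w + c` for all `w`, then coordinatewise
`ψ w + ⌊c/N⌋ ≤ ψ (α w) ≤ ψ w + ⌊c/N⌋ + 1` for the coarse chart `ψ = Φ.coarse = ⌊φ/N⌋`. [cite: KozmaNitzan2024, §4 p. 15 (boxes and their translates)] -/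
theorem coarse_rough_translate {α : G ≃g G} {c : Site 2} (hα : ∀ w, Φ.φ (α w) = Φ.φ w + c) (w : V) (i : Fin 2) :
    Φ.coarse w i + c i / (Φ.N : ℤ) ≤ Φ.coarse (α w) i ∧ Φ.coarse (α w) i ≤ Φ.coarse w i + c i / (Φ.N : ℤ) + 1 := by
  have h := ediv_add_ediv_le (Φ.φ w i) (c i) Φ.N_pos
  rw [coarse_apply, coarse_apply, hα w, Pi.add_apply]
  exact h

/-- Iterating a fine frame from a vertex: `φ (α^[k] v) = φ v + k • c`. [folklore] -/
theorem φ_iterate {α : G ≃g G} {c : Site 2} (hα : ∀ w, Φ.φ (α w) = Φ.φ w + c) (v : V) (k : ℕ) :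
    Φ.φ ((⇑α)^[k] v) = Φ.φ v + k • c := by
  induction k with
  | zero => simp
  | succ k ih => rw [Function.iterate_succ_apply', hα, ih, add_smul, one_smul, add_assoc]

/-- Iterating an exact coarse frame from a vertex: `ψ (α^[k] v) = ψ v + k • d`. [folklore] -/
theorem coarse_iterate {α : G ≃g G} {d : Site 2} (hd : ∀ w, Φ.coarse (α w) = Φ.coarse w + d) (v : V) (k : ℕ) :
    Φ.coarse ((⇑α)^[k] v) = Φ.coarse v + k • d := by
  induction k with
  | zero => simp
  | succ k ih => rw [Function.iterate_succ_apply', hd, ih, add_smul, one_smul, add_assoc]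

/-- **A fine frame is an EXACT coarse frame iff `N` divides its translation vector** (on a nonempty vertex set).  ⇐ is P3's
`coarse_translate_of_dvd`; ⇒: along the `α`-orbit of a vertex, `k ↦ ⌊(a + k cᵢ)/N⌋` would be the arithmetic progression `⌊a/N⌋ + k dᵢ`, so
`|k (N dᵢ − cᵢ)| < N` for every `k`, and `k = N` forces `N dᵢ = cᵢ`.  So the automorphism exchanging two DISTINCT coarse types (residues of `φ`
mod `N`) is never a frame of the coarse skeleton. [cite: KozmaNitzan2024, §4 p. 16 (Lemma 8: the role of the lattice symmetries)] -/
theorem coarse_translate_iff_dvd [Nonempty V] {α : G ≃g G} {c : Site 2} (hα : ∀ w, Φ.φ (α w) = Φ.φ w + c) :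
    (∃ d : Site 2, ∀ w, Φ.coarse (α w) = Φ.coarse w + d) ↔ ∀ i, (Φ.N : ℤ) ∣ c i := by
  constructor
  · rintro ⟨d, hd⟩ i
    obtain ⟨v⟩ := ‹Nonempty V›
    have hN := Φ.N_pos
    set e : ℤ := (Φ.N : ℤ) * d i - c i with he
    -- along the orbit: |k e| < N for every k
    have key : ∀ k : ℕ, |(k : ℤ) * e| < Φ.N := by
      intro k
      have hφ := congrFun (Φ.φ_iterate hα v k) i
      have hψ := congrFun (Φ.coarse_iterate hd v k) i
      rw [Pi.add_apply, Pi.smul_apply, nsmul_eq_mul] at hφ hψ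
      rw [coarse_apply, coarse_apply, hφ] at hψ
      -- `x = N (x/N) + x % N` for `x = φ v i + k c i` and for `x = φ v i`
      set a : ℤ := Φ.φ v i with ha
      have h1 := Int.mul_ediv_add_emod (a + k * c i) Φ.N
      have h2 := Int.mul_ediv_add_emod a Φ.N
      have r10 := Int.emod_nonneg (a + k * c i) hN.ne'
      have r11 := Int.emod_lt_of_pos (a + k * c i) hN
      have r20 := Int.emod_nonneg a hN.ne'
      have r21 := Int.emod_lt_of_pos a hN
      rw [hψ, mul_add] at h1
      rw [abs_lt]
      constructor <;> nlinarith
    have hkN := key Φ.N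
    rw [abs_mul, Nat.abs_cast] at hkN
    have he0 : |e| < 1 := by
      by_contra h
      rw [not_lt] at h
      have : (Φ.N : ℤ) * 1 ≤ (Φ.N : ℤ) * |e| := mul_le_mul_of_nonneg_left h hN.le
      linarith
    have he1 := abs_lt.1 he0
    have : e = 0 := by omega
    exact ⟨d i, by linarith⟩
  · intro hc
    exact ⟨fun i => c i / (Φ.N : ℤ), Φ.coarse_translate_of_dvd hα hc⟩

/-- **Residue types**: a fine frame by `c` preserves the residues of `φ` modulo `N` iff `N ∣ c` (given a vertex). [folklore] -/
theorem residue_preserved_iff_dvd [Nonempty V] {α : G ≃g G} {c : Site 2} (hα : ∀ w, Φ.φ (α w) = Φ.φ w + c) :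
    (∀ w i, Φ.φ (α w) i % (Φ.N : ℤ) = Φ.φ w i % (Φ.N : ℤ)) ↔ ∀ i, (Φ.N : ℤ) ∣ c i := by
  constructor
  · intro h i
    obtain ⟨v⟩ := ‹Nonempty V›
    have hv := h v i
    rw [hα v, Pi.add_apply, add_comm] at hv
    -- hv : (c i + φ v i) % N = φ v i % N
    have h2 : Int.ModEq (Φ.N : ℤ) (c i + Φ.φ v i) (0 + Φ.φ v i) := by rw [zero_add]; exact hv
    exact Int.modEq_zero_iff_dvd.1 (Int.ModEq.add_right_cancel' _ h2)
  · intro hc w i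
    obtain ⟨d, hd⟩ := hc i
    rw [hα w, Pi.add_apply, hd, Int.add_mul_emod_self_left]

/-- **Corollary: exchanging two distinct coarse types is never a coarse frame.**  If `φ (α w) = φ w + c` with `N ∤ cᵢ` for some `i` (so `α` moves the
residue type), there is NO `d` with `ψ ∘ α = ψ + d`. [cite: KozmaNitzan2024, §4 p. 16 (Lemma 8)] -/
theorem not_coarseFrame_of_not_dvd [Nonempty V] {α : G ≃g G} {c : Site 2} (hα : ∀ w, Φ.φ (α w) = Φ.φ w + c) {i : Fin 2}
    (hi : ¬ (Φ.N : ℤ) ∣ c i) : ¬ ∃ d : Site 2, ∀ w, Φ.coarse (α w) = Φ.coarse w + d :=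
  fun h => hi ((Φ.coarse_translate_iff_dvd hα).1 h i)

/-- **Sandwich, outer half: a fine frame carries a coarse cylinder INTO the next coarse cylinder at the image vertex**:
`α '' cyl ψ t n ⊆ cyl ψ (α t) (n + 1)`. [cite: KozmaNitzan2024, §4 p. 15 (boxes and their translates)] -/
theorem image_coarseCyl_subset {α : G ≃g G} {c : Site 2} (hα : ∀ w, Φ.φ (α w) = Φ.φ w + c) (t : V) (n : ℕ) :
    α '' Skelφ.cyl Φ.coarse t n ⊆ Skelφ.cyl Φ.coarse (α t) (n + 1) := by
  rintro _ ⟨w, hw, rfl⟩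
  rw [Skelφ.mem_cyl, mem_box] at hw ⊢
  intro i
  have h := hw i
  have h1 := Φ.coarse_rough_translate hα w i
  have h2 := Φ.coarse_rough_translate hα t i
  rw [Pi.sub_apply] at h ⊢
  push_cast
  constructor <;> linarith [h.1, h.2]

/-- **Sandwich, inner half: the coarse cylinder at the image vertex lies in the image of the next coarse cylinder**:
`cyl ψ (α t) n ⊆ α '' cyl ψ t (n + 1)`. [cite: KozmaNitzan2024, §4 p. 15 (boxes and their translates)] -/
theorem coarseCyl_subset_image {α : G ≃g G} {c : Site 2} (hα : ∀ w, Φ.φ (α w) = Φ.φ w + c) (t : V) (n : ℕ) :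
    Skelφ.cyl Φ.coarse (α t) n ⊆ α '' Skelφ.cyl Φ.coarse t (n + 1) := by
  intro y hy
  refine ⟨α.symm y, ?_, RelIso.apply_symm_apply α y⟩
  rw [Skelφ.mem_cyl, mem_box] at hy ⊢
  intro i
  have h := hy i
  have h1 := Φ.coarse_rough_translate hα (α.symm y) i
  have h2 := Φ.coarse_rough_translate hα t i
  rw [RelIso.apply_symm_apply] at h1
  rw [Pi.sub_apply] at h ⊢
  push_cast
  constructor <;> linarith [h.1, h.2]

/-! ## §3 The step length never exceeds the Lipschitz constant -/

/-- **`N ≤ L`** at any vertex: an exact `N`-step is an edge of `φ`-length `N`, bounded by the Lipschitz constant.  (So P3's dictionary regime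
`L ≤ N` is `L = N`.) [folklore] -/
theorem N_le_L (v : V) : Φ.N ≤ Φ.L := by
  obtain ⟨v', hadj, hφ⟩ := Φ.step v 0 1
  have h := Φ.lip hadj 0
  rw [hφ, Pi.add_apply, Pi.single_eq_same, Units.val_one, mul_one] at h
  have h' : |(-(Φ.N : ℤ))| ≤ Φ.L := by
    have e : Φ.φ v 0 - (Φ.φ v 0 + (Φ.N : ℤ)) = -(Φ.N : ℤ) := by ring
    rwa [e] at h
  rw [abs_neg, Nat.abs_cast] at h'
  exact_mod_cast h'

/-! ## §4 (appended, p5 gen 24, DATUM M1) The EXACT offset of a fine frame on the coarse chart: `+1` precisely on the residues that wrap -/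

/-- **Exact rough additivity of the Euclidean quotient**: `(a + c)/N = a/N + c/N + [N ≤ a % N + c % N]` (`N > 0`). [folklore] -/
theorem ediv_add_eq_ite (a c : ℤ) {N : ℤ} (hN : 0 < N) :
    (a + c) / N = a / N + c / N + (if N ≤ a % N + c % N then 1 else 0) := by
  have ha := Int.mul_ediv_add_emod a N
  have hc := Int.mul_ediv_add_emod c N
  have ha0 := Int.emod_nonneg a hN.ne'
  have hc0 := Int.emod_nonneg c hN.ne'
  have ha1 := Int.emod_lt_of_pos a hN
  have hc1 := Int.emod_lt_of_pos c hN
  have hsum : a + c = (a % N + c % N) + N * (a / N + c / N) := by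
    rw [mul_add]
    linarith
  have hq : (a + c) / N = (a % N + c % N) / N + (a / N + c / N) := by
    rw [hsum, Int.add_mul_ediv_left _ _ hN.ne']
  rw [hq]
  split_ifs with h
  · -- `N ≤ r < 2N` ⟹ `r / N = 1`
    have h1 : (a % N + c % N) / N = 1 := by
      have e : a % N + c % N = (a % N + c % N - N) + 1 * N := by ring
      rw [e, Int.add_mul_ediv_right _ _ hN.ne', Int.ediv_eq_zero_of_lt (by linarith) (by linarith)]
      ring
    rw [h1]; ring
  · rw [not_le] at h
    rw [Int.ediv_eq_zero_of_lt (by linarith) h]; ring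

/-- **THE EXACT OFFSET (DATUM M1-b)**: for a fine frame `α` (`φ ∘ α = φ + c`), the coarse chart moves by `⌊c/N⌋` PLUS ONE exactly at the vertices whose residue wraps:
`ψ (α w) i = ψ w i + cᵢ/N + [N ≤ φ w i % N + cᵢ % N]`.  So the pull-back under `α` of any set defined by inequalities on `ψ − ψ (α t)` is the same set of inequalities on the
SHIFTED coarse chart `⌊(φ + c)/N⌋ − ⌊(φ t + c)/N⌋` — not on `ψ − ψ t` — unless `N ∣ c`. [cite: KozmaNitzan2024, §4 p. 15 (boxes and their translates)] -/
theorem coarse_translate_eq_ite {α : G ≃g G} {c : Site 2} (hα : ∀ w, Φ.φ (α w) = Φ.φ w + c) (w : V) (i : Fin 2) :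
    Φ.coarse (α w) i = Φ.coarse w i + c i / (Φ.N : ℤ) + (if (Φ.N : ℤ) ≤ Φ.φ w i % (Φ.N : ℤ) + c i % (Φ.N : ℤ) then 1 else 0) := by
  rw [coarse_apply, coarse_apply, hα w, Pi.add_apply]
  exact ediv_add_eq_ite (Φ.φ w i) (c i) Φ.N_pos

/-- **The shifted coarse chart is the pulled-back chart**: `ψ (α w) = ⌊(φ w + c)/N⌋` coordinatewise, i.e. `Φ.coarse ∘ α` is the coarse chart of the fine chart shifted by `c`.
(Immediate from `φ ∘ α = φ + c`; recorded as the dictionary entry "type exchange = change of coarse grid".) [folklore] -/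
theorem coarse_comp_frame {α : G ≃g G} {c : Site 2} (hα : ∀ w, Φ.φ (α w) = Φ.φ w + c) (w : V) (i : Fin 2) :
    Φ.coarse (α w) i = (Φ.φ w i + c i) / (Φ.N : ℤ) := by
  rw [coarse_apply, hα w, Pi.add_apply]

/-- **Relative form at a base vertex**: if `φ t i % N = 0` (coordinates measured in `t`'s residue frame), then along the frame `α` the RELATIVE coarse coordinate
`ψ (α w) i − ψ (α t) i` equals `ψ w i − ψ t i` plus ONE exactly when `w`'s residue wraps: `[N ≤ φ w i % N + cᵢ % N]` — the offset is never a uniform shift of the family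
(DATUM M1-b: transporting `t`'s coarse pieces along `α` lands in the SHIFTED grid's pieces, not in the image type's). [cite: KozmaNitzan2024, §4 p. 15] -/
theorem coarse_rel_translate_eq_ite {α : G ≃g G} {c : Site 2} (hα : ∀ w, Φ.φ (α w) = Φ.φ w + c) {t : V} {i : Fin 2}
    (ht : Φ.φ t i % (Φ.N : ℤ) = 0) (w : V) :
    Φ.coarse (α w) i - Φ.coarse (α t) i =
      Φ.coarse w i - Φ.coarse t i + (if (Φ.N : ℤ) ≤ Φ.φ w i % (Φ.N : ℤ) + c i % (Φ.N : ℤ) then 1 else 0) := by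
  have hw := Φ.coarse_translate_eq_ite hα w i
  have htt := Φ.coarse_translate_eq_ite hα t i
  have hlt : ¬ ((Φ.N : ℤ) ≤ Φ.φ t i % (Φ.N : ℤ) + c i % (Φ.N : ℤ)) := by
    rw [ht, zero_add, not_le]
    exact Int.emod_lt_of_pos _ Φ.N_pos
  rw [if_neg hlt, add_zero] at htt
  rw [hw, htt]
  ring

end PlanarSkeletonFrmScaled

end Summit.CriticalPhenomena.PercolationContinuityZ3.Theorems.Transplant

end
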